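import Mathlib
import Summits.ValiantsHypothesis.ValiantsHypothesis.Theorems.GrenetZeonTwoDimCoefficientsScalingIndexHessianRate
import Summits.ValiantsHypothesis.ValiantsHypothesis.Theorems.GrenetZeonTwoDimCoefficientsDualUnipotentConstrainedPencil
import Summits.ValiantsHypothesis.ValiantsHypothesis.Theorems.GrenetZeonTwoDimCoefficientsScalingSupportRank

/-!
# Crux `GrenetZeon.TwoDimCoefficients` (stmt-ValiantsHypothesis-8062) / rung `DualUnipotentThreeHalves` (stmt-24318):
# scaling-closure — THE MASS CUT IN HESSIAN CURRENCY: an index-`n` constituent plus SUPPORT garbage (unconditional)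

The substitution route (T4 / index-cost) is killed by König garbage (memo NINETEENTH-HAND.md §9): a garbage constituent supported on
the variables of one row forces every index-reducing section into `{row r = 0}`.  In HESSIAN currency the same garbage is CHEAP: its
trace contribution `g` is linear off the `n` row variables, so `rank Hess g ≤ 2n` everywhere (✓ `rank_hess0_transl_le_of_pderiv_pderiv_eq_zero`),
while an index-`n` constituent of size `m₁` contributes rank `≤ 2m₁²/n` (✓ per-free Hessian-rate law `rank_hess0_top_mul_le_of_index`,
p835784) — and ranks ADD.  No substitution, no per-genericity, no section:

  `per_n = [tr(adj(1 − N₁)·M₁)]_n + g`, `N₁` linear with `N₁ⁿ = 0` (size `m₁`), `g` linear off a variable set `S`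
  ⟹ `(n² − 2|S|)·n ≤ 2m₁²`.

So König / scalar / any bounded-support garbage (`|S| ≤ n²/4`) leaves the 3/2 rung intact: `n³ ≤ 4m₁²`.  This is the census's MASS CUT
transported from power currency to Hessian currency, for the two constituent types priced so far (index-`n`: rate `2m²/n`; support-`S`:
flat price `2|S|`); the located open constituent type is the wild/triangular block of large index on many variables (MIXED, memo §9).

* ★★★ `sq_sub_mul_le_of_indexPart_add_supportPart` — the inequality above (top numerator of an index-`n` unipotent pencil plus support garbage).

HONEST FRAMING: unconditional but for DECOMPOSED representations (the user supplies the split `per = top numerator + g`); the stub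
`DualUnipotentBound`, crux 8062, the 24318 decl and `VP ≠ VNP` remain open.

References: T. Mignon, N. Ressayre, Int. Math. Res. Not. 2004:79, Thm. 1.1 (via the tree); folklore.
-/

-- single-conjunct layout `Summits/ValiantsHypothesis/ValiantsHypothesis`: the duplicated namespace
-- component is mandated by the tree.
set_option linter.dupNamespace false
set_option autoImplicit false

noncomputable section

namespace Summit.ValiantsHypothesis.ValiantsHypothesis.Theorems.GrenetZeonTwoDimCoefficients.ScalingClosure

open MvPolynomial Matrix
open Literature.Computability.AlgebraicComplexity
open Summit.ValiantsHypothesis.ValiantsHypothesis.Cruxes.TwoDimCoefficients.DimTwoCases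

section HessianMassCut

/-- ★★★ **Mass cut in Hessian currency (index-`n` constituent + support garbage).**  If
`per_n = [tr(adj(1 − N₁)·M₁)]_n + g` with `N₁` an `m₁ × m₁` matrix of linear forms, `N₁ⁿ = 0` and `N₁^{m₁} = 0`, `M₁` affine, and
`g` LINEAR OFF the variable set `S` (`∂_c∂_{c'} g = 0` for `c, c' ∉ S`), then `(n² − 2|S|)·n ≤ 2m₁²` (`n ≥ 2`).
Proof: at the identity permutation point `rank Hess per_n = n²` (✓ p836772); ranks add; ✓ p835784 and ✓ support bound.
[cite: MignonRessayre2004, Thm. 1.1 — via the tree; folklore] -/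
theorem sq_sub_mul_le_of_indexPart_add_supportPart {n m₁ : ℕ} (hn : 2 ≤ n) (N₁ M₁ : AffMat n m₁)
    (hN₁ : ∀ i j, (N₁ i j).IsHomogeneous 1) (hM₁ : IsAffine M₁) (hNn : N₁ ^ n = 0) (hNm : N₁ ^ m₁ = 0)
    (g : MvPolynomial (Fin n × Fin n) ℂ) (S : Finset (Fin n × Fin n))
    (hg : ∀ c c', c ∉ S → c' ∉ S → pderiv c (pderiv c' g) = 0)
    (hper : perPoly (Fin n) ℂ = homogeneousComponent n (((1 - N₁).adjugate * M₁).trace) + g) :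
    (n ^ 2 - 2 * S.card) * n ≤ 2 * m₁ ^ 2 := by
  classical
  -- the unipotent pencil `A = 1 − N₁ = 1·(1 − N₁)`
  obtain ⟨c, hc, hdet⟩ := exists_det_one_sub_eq_C N₁ hNm
  have hA : IsAffine (1 - N₁) := by
    intro i j
    rw [Matrix.sub_apply]
    refine (totalDegree_sub _ _).trans (max_le ?_ (hN₁ i j).totalDegree_le)
    rw [Matrix.one_apply]
    split_ifs
    · rw [totalDegree_one]; exact Nat.zero_le _
    · rw [totalDegree_zero]; exact Nat.zero_le _
  have hAN : (1 - N₁ : AffMat n m₁) = (1 : Matrix (Fin m₁) (Fin m₁) ℂ).map MvPolynomial.C * (1 - N₁) := by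
    rw [Matrix.map_one MvPolynomial.C (map_zero _) (map_one _), Matrix.one_mul]
  -- the full-rank point and additivity
  set z : Fin n × Fin n → ℂ := fun u => if u.1 = (1 : Equiv.Perm (Fin n)) u.2 then (1 : ℂ) else 0 with hz
  set P := homogeneousComponent n (((1 - N₁).adjugate * M₁).trace) with hP
  have hsplit : hess0 (transl z (perPoly (Fin n) ℂ)) = hess0 (transl z P) + hess0 (transl z g) := by
    ext s t
    rw [Matrix.add_apply, hess0_transl, hess0_transl, hess0_transl, hper, map_add, map_add, map_add]
  have hrankP : (hess0 (transl z P)).rank * n ≤ 2 * m₁ ^ 2 :=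
    rank_hess0_top_mul_le_of_index hn (1 - N₁) M₁ hA hM₁ c hc hdet 1 1 (Matrix.mul_one 1) N₁ hN₁ hNn hAN z
  have hrankg : (hess0 (transl z g)).rank ≤ 2 * S.card := rank_hess0_transl_le_of_pderiv_pderiv_eq_zero g S hg z
  have hfull : (hess0 (transl z (perPoly (Fin n) ℂ))).rank = n ^ 2 := rank_hess0_transl_permPoint_perPoly hn 1
  have hadd : ∀ A' B' : Matrix (Fin n × Fin n) (Fin n × Fin n) ℂ, (A' + B').rank ≤ A'.rank + B'.rank := by
    intro A' B'
    unfold Matrix.rank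
    rw [Matrix.mulVecLin_add]
    calc Module.finrank ℂ (LinearMap.range (A'.mulVecLin + B'.mulVecLin))
        ≤ Module.finrank ℂ ↥(LinearMap.range A'.mulVecLin ⊔ LinearMap.range B'.mulVecLin) := by
          apply Submodule.finrank_mono
          rintro _ ⟨v, rfl⟩
          exact Submodule.add_mem_sup ⟨v, rfl⟩ ⟨v, rfl⟩
      _ ≤ _ := Submodule.finrank_add_le_finrank_add_finrank _ _
  have hle : n ^ 2 ≤ (hess0 (transl z P)).rank + 2 * S.card := by
    rw [← hfull, hsplit]
    exact (hadd _ _).trans (Nat.add_le_add_left hrankg _)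
  have h1 : n ^ 2 - 2 * S.card ≤ (hess0 (transl z P)).rank := by omega
  exact (Nat.mul_le_mul_right _ h1).trans hrankP

/-- ★★★ **Mass cut in Hessian currency, several index-`n` constituents.**  If
`per_n = Σ_{i<r} κ_i·[tr(adj(1 − N_i)·M_i)]_n + g` with each `N_i` an `m_i × m_i` matrix of linear forms, `N_iⁿ = 0`, `N_i^{m_i} = 0`,
`M_i` affine, scalars `κ_i`, and `g` linear off the variable set `S`, then `(n² − 2|S|)·n ≤ 2·Σ_i m_i²` (`n ≥ 2`) — the rates of the
constituents ADD (✓ p835784 each), the support garbage costs `2|S|` (✓ p838203).  Since `Σ m_i² ≤ (Σ m_i)²`, block-diagonal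
representations with index-`n` blocks and bounded-support garbage obey the 3/2 rung. [cite: MignonRessayre2004, Thm. 1.1 — via the
tree; folklore] -/
theorem sq_sub_mul_le_of_indexParts_add_supportPart {n r : ℕ} (hn : 2 ≤ n) (m : Fin r → ℕ)
    (N M : ∀ i : Fin r, AffMat n (m i)) (κ : Fin r → ℂ)
    (hN : ∀ i a b, (N i a b).IsHomogeneous 1) (hM : ∀ i, IsAffine (M i)) (hNn : ∀ i, N i ^ n = 0)
    (hNm : ∀ i, N i ^ (m i) = 0)
    (g : MvPolynomial (Fin n × Fin n) ℂ) (S : Finset (Fin n × Fin n))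
    (hg : ∀ c c', c ∉ S → c' ∉ S → pderiv c (pderiv c' g) = 0)
    (hper : perPoly (Fin n) ℂ =
      (∑ i, MvPolynomial.C (κ i) * homogeneousComponent n (((1 - N i).adjugate * M i).trace)) + g) :
    (n ^ 2 - 2 * S.card) * n ≤ 2 * ∑ i, m i ^ 2 := by
  classical
  set z : Fin n × Fin n → ℂ := fun u => if u.1 = (1 : Equiv.Perm (Fin n)) u.2 then (1 : ℂ) else 0 with hz
  -- each constituent: affine unipotent pencil data and the per-free rate
  have hrate : ∀ i, (hess0 (transl z (homogeneousComponent n (((1 - N i).adjugate * M i).trace)))).rank * n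
      ≤ 2 * m i ^ 2 := by
    intro i
    obtain ⟨c, hc, hdet⟩ := exists_det_one_sub_eq_C (N i) (hNm i)
    have hA : IsAffine (1 - N i) := by
      intro a b
      rw [Matrix.sub_apply]
      refine (totalDegree_sub _ _).trans (max_le ?_ (hN i a b).totalDegree_le)
      rw [Matrix.one_apply]
      split_ifs
      · rw [totalDegree_one]; exact Nat.zero_le _
      · rw [totalDegree_zero]; exact Nat.zero_le _
    have hAN : (1 - N i : AffMat n (m i)) = (1 : Matrix (Fin (m i)) (Fin (m i)) ℂ).map MvPolynomial.C * (1 - N i) := by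
      rw [Matrix.map_one MvPolynomial.C (map_zero _) (map_one _), Matrix.one_mul]
    exact rank_hess0_top_mul_le_of_index hn (1 - N i) (M i) hA (hM i) c hc hdet 1 1 (Matrix.mul_one 1) (N i) (hN i)
      (hNn i) hAN z
  -- additivity of the Hessian and subadditivity of the rank
  have hsplit : hess0 (transl z (perPoly (Fin n) ℂ)) =
      (∑ i, κ i • hess0 (transl z (homogeneousComponent n (((1 - N i).adjugate * M i).trace)))) +
        hess0 (transl z g) := by
    ext s t
    rw [Matrix.add_apply, hess0_transl, hess0_transl, hper, map_add, map_add, map_add, map_sum, map_sum, map_sum,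
      Matrix.sum_apply]
    congr 1
    refine Finset.sum_congr rfl fun i _ => ?_
    rw [Matrix.smul_apply, hess0_transl, smul_eq_mul, pderiv_C_mul, pderiv_C_mul, map_mul, MvPolynomial.eval_C]
  have hadd : ∀ A' B' : Matrix (Fin n × Fin n) (Fin n × Fin n) ℂ, (A' + B').rank ≤ A'.rank + B'.rank := by
    intro A' B'
    unfold Matrix.rank
    rw [Matrix.mulVecLin_add]
    calc Module.finrank ℂ (LinearMap.range (A'.mulVecLin + B'.mulVecLin))
        ≤ Module.finrank ℂ ↥(LinearMap.range A'.mulVecLin ⊔ LinearMap.range B'.mulVecLin) := by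
          apply Submodule.finrank_mono
          rintro _ ⟨v, rfl⟩
          exact Submodule.add_mem_sup ⟨v, rfl⟩ ⟨v, rfl⟩
      _ ≤ _ := Submodule.finrank_add_le_finrank_add_finrank _ _
  have hfull : (hess0 (transl z (perPoly (Fin n) ℂ))).rank = n ^ 2 := rank_hess0_transl_permPoint_perPoly hn 1
  have hrankg : (hess0 (transl z g)).rank ≤ 2 * S.card := rank_hess0_transl_le_of_pderiv_pderiv_eq_zero g S hg z
  have hsum : (∑ i, κ i • hess0 (transl z (homogeneousComponent n (((1 - N i).adjugate * M i).trace)))).rank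
      ≤ ∑ i, (hess0 (transl z (homogeneousComponent n (((1 - N i).adjugate * M i).trace)))).rank :=
    (rank_sum_le _ _).trans (Finset.sum_le_sum fun i _ => rank_smul_le _ _)
  have hle : n ^ 2 ≤ (∑ i, (hess0 (transl z (homogeneousComponent n (((1 - N i).adjugate * M i).trace)))).rank)
      + 2 * S.card := by
    rw [← hfull, hsplit]
    exact (hadd _ _).trans (add_le_add hsum hrankg)
  have h1 : (n ^ 2 - 2 * S.card) * n
      ≤ (∑ i, (hess0 (transl z (homogeneousComponent n (((1 - N i).adjugate * M i).trace)))).rank) * n :=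
    Nat.mul_le_mul_right _ (by omega)
  refine h1.trans ?_
  rw [Finset.sum_mul, Finset.mul_sum]
  exact Finset.sum_le_sum fun i _ => hrate i

/-- The top numerator of the unipotent pencil `1 − N` against a LINEAR `M` is `c·tr(N^{n−1} M)` (`c = det(1 − N)`), when `Nⁿ = 0`
(✓ `homogeneousComponent_adjugate_mul_of_index`, entrywise, summed over the diagonal). [folklore] -/
theorem homogeneousComponent_trace_adjugate_one_sub_mul {n m₁ : ℕ} (hn : 1 ≤ n) (N M : AffMat n m₁)
    (hN : ∀ i j, (N i j).IsHomogeneous 1) (hM : ∀ i j, (M i j).IsHomogeneous 1) (hNn : N ^ n = 0)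
    {c : ℂ} (hc : c ≠ 0) (hdet : (1 - N).det = MvPolynomial.C c) :
    homogeneousComponent n (((1 - N).adjugate * M).trace) = MvPolynomial.C c * (N ^ (n - 1) * M).trace := by
  classical
  have hAN : (1 - N : AffMat n m₁) = (1 : Matrix (Fin m₁) (Fin m₁) ℂ).map MvPolynomial.C * (1 - N) := by
    rw [Matrix.map_one MvPolynomial.C (map_zero _) (map_one _), Matrix.one_mul]
  have hMaff : ∀ i j, (M i j).totalDegree ≤ 1 := fun i j => (hM i j).totalDegree_le
  have hB1 : ∀ a b, M a b = homogeneousComponent 1 (M a b) := fun a b => by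
    rw [homogeneousComponent_of_mem ((mem_homogeneousSubmodule 1 _).mpr (hM a b)), if_pos rfl]
  rw [Matrix.trace, Matrix.trace, map_sum, Finset.mul_sum]
  refine Finset.sum_congr rfl fun i _ => ?_
  rw [Matrix.diag_apply, Matrix.diag_apply,
    homogeneousComponent_adjugate_mul_of_index hn 1 1 (Matrix.mul_one 1) N hN hNn (1 - N) hAN c hc hdet M hMaff M hB1 i i,
    Matrix.map_one MvPolynomial.C (map_zero _) (map_one _), Matrix.one_mul]

/-- ★★★ **Mass cut in Hessian currency — NORMAL-FORM version.**  If `per_n = Σ_{i<r} κ_i·tr(N_i^{n−1}·M_i) + g` with `N_i, M_i`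
matrices of LINEAR forms of size `m_i`, `N_iⁿ = 0`, `N_i^{m_i} = 0`, and `g` linear off the variable set `S`, then
`(n² − 2|S|)·n ≤ 2·Σ_i m_i²` (`n ≥ 2`).  (For a representation in the normal form `per_n = tr(N^{n−1} M)` of
✓ `exists_nilpotent_pencil_of_dualUnipotentRepr` whose pencil `N` is block-DIAGONAL with index-`n` blocks, the block traces give
exactly such a decomposition with `g = 0`; König / scalar / bounded-support garbage blocks go into `g`.) [cite: MignonRessayre2004,
Thm. 1.1 — via the tree; folklore] -/
theorem sq_sub_mul_le_of_tracePowParts_add_supportPart {n r : ℕ} (hn : 2 ≤ n) (m : Fin r → ℕ)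
    (N M : ∀ i : Fin r, AffMat n (m i)) (κ : Fin r → ℂ)
    (hN : ∀ i a b, (N i a b).IsHomogeneous 1) (hM : ∀ i a b, (M i a b).IsHomogeneous 1) (hNn : ∀ i, N i ^ n = 0)
    (hNm : ∀ i, N i ^ (m i) = 0)
    (g : MvPolynomial (Fin n × Fin n) ℂ) (S : Finset (Fin n × Fin n))
    (hg : ∀ c c', c ∉ S → c' ∉ S → pderiv c (pderiv c' g) = 0)
    (hper : perPoly (Fin n) ℂ = (∑ i, MvPolynomial.C (κ i) * (N i ^ (n - 1) * M i).trace) + g) :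
    (n ^ 2 - 2 * S.card) * n ≤ 2 * ∑ i, m i ^ 2 := by
  classical
  -- constants `c_i = det(1 − N_i)` and the rescaled coefficients
  have hc : ∀ i, ∃ c : ℂ, c ≠ 0 ∧ (1 - N i).det = MvPolynomial.C c := fun i => exists_det_one_sub_eq_C (N i) (hNm i)
  choose c hc0 hcdet using hc
  refine sq_sub_mul_le_of_indexParts_add_supportPart hn m N M (fun i => κ i * (c i)⁻¹) hN
    (fun i a b => (hM i a b).totalDegree_le) hNn hNm g S hg ?_
  rw [hper]
  congr 1
  refine Finset.sum_congr rfl fun i _ => ?_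
  rw [homogeneousComponent_trace_adjugate_one_sub_mul (by omega) (N i) (M i) (hN i) (hM i) (hNn i) (hc0 i) (hcdet i),
    ← mul_assoc, ← map_mul, mul_assoc, inv_mul_cancel₀ (hc0 i), mul_one]

end HessianMassCut

end Summit.ValiantsHypothesis.ValiantsHypothesis.Theorems.GrenetZeonTwoDimCoefficients.ScalingClosure

end
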